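import Mathlib
import Summits.Ventures.PercRepro2.KPrimeReduction
import Summits.Ventures.PercRepro2.KPrimeDelProb
import Summits.Ventures.PercRepro2.PSRecords

/-!
# The `(H − D)`-piece of the glue, one world: PA of the avoided cluster of `a₂`
(blind cell PercRepro2, mine-c g37; `conjectures/MINE-C.md` §46.10 (e), §46.11)

With `Q = {a₂ ↮ a₁}` and `Z = {a₂ ↮ z}`, `P(U∩Ω∩Yᶜ) · P(N ∩ Z) ≤ P(U∩Ω∩Yᶜ ∩ Z) · P(N)`
(`hd_avoid_pa`; `Y = {a₂ ↔ y}`): fibre over the cluster `L = C(a₂)` (which avoids `a₁` on `Q`) —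
given `L` the rest of the graph is i.i.d. and `{a₁ ↔ v}` is deletion-stable
(`deletionStable_connEvent`: the cluster of `a₁` is untouched by the deletion of the edges at
`L`), so `P(U∩Ω∩Yᶜ) = E[1[y ∉ L] · P_{G∖L}(a₁ ↔ v) · 1_Q]`, a DECREASING functional of `L`,
`P(N) = E[P_{G∖L}(a₁ ↮ v) · 1_Q]` an INCREASING one, and `1[z ∉ L]` is decreasing; the cluster
of `a₂` given `Q` is positively associated (BHK06 Thm 1.3, `PSRecords.bhk_same_cluster_anti` for
two decreasing functionals, `bhk_same_cluster` with `1 − 1[z ∉ L]` for the mixed pair), so the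
`Z`-share of `U∩Ω∩Yᶜ` is at least `P(Z | Q)` and the `Z`-share of `N` is at most `P(Z | Q)`;
`ratio_combine` is the algebra of the two steps.  The leak dictionary and the cross-world
theorem `glue_piece_hd` are in `KPrimeLeakGlueHD.lean`.
-/

namespace Summit.Ventures.PercRepro2

namespace KPrime

variable {V : Type*} {E : Type*} [Fintype E] [DecidableEq E] [Fintype V] [DecidableEq V]
  {R : Type*} [Field R] [LinearOrder R] [IsStrictOrderedRing R]

section OneWorld

variable {ends : E → Sym2 V} {a₁ a₂ v y z : V} {p : E → R}

omit [Fintype E] [DecidableEq E] [Fintype V] [DecidableEq V] [Field R] [LinearOrder R]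
  [IsStrictOrderedRing R] in
/-- `{a₂ ↮ a₁}` as an avoidance of `a₂` is the complement of the connection event. -/
lemma avoidAll_singleton_eq_compl (s t : V) :
    avoidAll ends s {t} = (connEvent ends s t)ᶜ := by
  ext ω
  simp [avoidAll, connEvent]

omit [Fintype E] [DecidableEq E] [Fintype V] [DecidableEq V] [Field R] [LinearOrder R]
  [IsStrictOrderedRing R] in
/-- `Ω = {a₁ ↮ a₂}` is the avoidance of `a₂` of `{a₁}`. -/
lemma Ω_eq_avoidAll_swap : Ω ends a₁ a₂ = avoidAll ends a₂ {a₁} := by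
  ext ω
  simp only [Ω, avoidAll, Set.mem_setOf_eq, Finset.mem_singleton, forall_eq]
  exact ⟨fun h hc => h (conn_symm hc), fun h hc => h (conn_symm hc)⟩

omit [Fintype E] [DecidableEq E] [Fintype V] [Field R] [LinearOrder R]
  [IsStrictOrderedRing R] in
/-- `N = {a₁ ↮ a₂} ∩ {a₁ ↮ v}`. -/
lemma N_eq_inter : N ends a₁ a₂ v = (connEvent ends a₁ v)ᶜ ∩ avoidAll ends a₂ {a₁} := by
  ext ω
  simp only [N, avoidAll, Set.mem_inter_iff, Set.mem_compl_iff, mem_connEvent, Set.mem_setOf_eq,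
    Finset.mem_insert, Finset.mem_singleton, forall_eq_or_imp, forall_eq]
  constructor
  · rintro ⟨h₂, hv⟩
    exact ⟨hv, fun hc => h₂ (conn_symm hc)⟩
  · rintro ⟨hv, h₂⟩
    exact ⟨fun hc => h₂ (conn_symm hc), hv⟩

omit [Fintype E] [DecidableEq E] [Fintype V] [DecidableEq V] [Field R] [LinearOrder R]
  [IsStrictOrderedRing R] in
/-- `{a₁ ↔ v}` is deletion-stable along the cluster of `a₂` on `{a₂ ↮ a₁}`: the cluster of
`a₁` is untouched by the deletion of the edges at `C(a₂)`. -/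
lemma deletionStable_connEvent {ω : Config E} (hω : ω ∈ avoidAll ends a₂ {a₁}) :
    ω ∈ connEvent ends a₁ v ↔
      delConfig ends (cluster ends ω a₂) ω ∈ connEvent ends a₁ v := by
  have ha₁ : a₁ ∉ cluster ends ω a₂ := fun h => hω a₁ (by simp) h
  have e := cluster_delConfig_cluster (ends := ends) (ω := ω) (s := a₂) ha₁
  simp only [mem_connEvent]
  constructor
  · intro h
    have h' : v ∈ cluster ends ω a₁ := h
    rw [← e] at h'
    exact h'
  · intro h
    have h' : v ∈ cluster ends (delConfig ends (cluster ends ω a₂) ω) a₁ := h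
    rw [e] at h'
    exact h'

omit [Fintype E] [DecidableEq E] [Fintype V] [DecidableEq V] [Field R] [LinearOrder R]
  [IsStrictOrderedRing R] in
/-- `{a₁ ↮ v}` is deletion-stable along the cluster of `a₂` on `{a₂ ↮ a₁}`. -/
lemma deletionStable_connEvent_compl {ω : Config E} (hω : ω ∈ avoidAll ends a₂ {a₁}) :
    ω ∈ (connEvent ends a₁ v)ᶜ ↔
      delConfig ends (cluster ends ω a₂) ω ∈ (connEvent ends a₁ v)ᶜ := by
  simp only [Set.mem_compl_iff]
  exact not_congr (deletionStable_connEvent hω)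

omit [Fintype V] [DecidableEq V] [LinearOrder R] [IsStrictOrderedRing R] in
/-- `delProb` of a complement. -/
lemma delProb_compl (B : Set (Config E)) (W : Set V) :
    delProb p ends Bᶜ W = 1 - delProb p ends B W := by
  unfold delProb
  rw [← prob_compl]
  congr 1

omit [Fintype V] [DecidableEq V] in
/-- `delProb` is at most `1`. -/
lemma delProb_le_one' (hp : IsProbVec p) (B : Set (Config E)) (W : Set V) :
    delProb p ends B W ≤ 1 :=
  prob_le_one hp _

omit [Fintype E] [DecidableEq E] [Fintype V] [DecidableEq V] in
/-- The algebra of the two BHK steps: from `a·g ≤ c·q` and `e·q ≤ d·g` (with `0 ≤ a ≤ q`,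
`0 ≤ c, d`) conclude `a·e ≤ c·d`. -/
lemma ratio_combine {a c d e g q : R} (h1 : a * g ≤ c * q) (h2 : e * q ≤ d * g)
    (ha : 0 ≤ a) (hc : 0 ≤ c) (hd : 0 ≤ d) (hq : 0 ≤ q) (haq : a ≤ q) : a * e ≤ c * d := by
  rcases eq_or_lt_of_le hq with hq0 | hqpos
  · have haq0 : a ≤ 0 := by rw [hq0]; exact haq
    have ha' : a = 0 := le_antisymm haq0 ha
    rw [ha', zero_mul]
    exact mul_nonneg hc hd
  · have h3 : a * e * q ≤ c * d * q := by nlinarith [h1, h2, ha, hd]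
    exact le_of_mul_le_mul_right h3 hqpos

/-- **PA of the avoided cluster of `a₂`, in the base world**: with `Q = {a₂ ↮ a₁}` and
`Z = {a₂ ↮ z}`, `P(U∩Ω∩Yᶜ) · P(N ∩ Z) ≤ P(U∩Ω∩Yᶜ ∩ Z) · P(N)`. -/
theorem hd_avoid_pa (hp : IsProbVec p) :
    prob p (connEvent ends a₁ v ∩ Ω ends a₁ a₂ ∩ (connEvent ends a₂ y)ᶜ) *
        prob p (N ends a₁ a₂ v ∩ (connEvent ends a₂ z)ᶜ) ≤
      prob p (connEvent ends a₁ v ∩ Ω ends a₁ a₂ ∩ (connEvent ends a₂ y)ᶜ ∩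
          (connEvent ends a₂ z)ᶜ) *
        prob p (N ends a₁ a₂ v) := by
  classical
  -- the four masses as cluster events of `a₂` under the avoidance of `a₁`
  have eU : connEvent ends a₁ v ∩ Ω ends a₁ a₂ ∩ (connEvent ends a₂ y)ᶜ =
      clusterInEvent ends a₂ {L : Set V | y ∉ L} ∩ connEvent ends a₁ v ∩ avoidAll ends a₂ {a₁} := by
    rw [Ω_eq_avoidAll_swap]
    ext ω
    simp only [Set.mem_inter_iff, Set.mem_compl_iff, mem_connEvent, mem_clusterInEvent,
      Set.mem_setOf_eq, mem_cluster]
    tauto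
  have eUZ : connEvent ends a₁ v ∩ Ω ends a₁ a₂ ∩ (connEvent ends a₂ y)ᶜ ∩
      (connEvent ends a₂ z)ᶜ = clusterInEvent ends a₂ ({L : Set V | y ∉ L} ∩ {L : Set V | z ∉ L}) ∩
        connEvent ends a₁ v ∩ avoidAll ends a₂ {a₁} := by
    rw [Ω_eq_avoidAll_swap]
    ext ω
    simp only [Set.mem_inter_iff, Set.mem_compl_iff, mem_connEvent, mem_clusterInEvent,
      Set.mem_setOf_eq, mem_cluster]
    tauto
  have eN : N ends a₁ a₂ v =
      clusterInEvent ends a₂ Set.univ ∩ (connEvent ends a₁ v)ᶜ ∩ avoidAll ends a₂ {a₁} := by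
    rw [N_eq_inter]
    ext ω
    simp only [Set.mem_inter_iff, mem_clusterInEvent, Set.mem_univ, true_and]
  have eNZ : N ends a₁ a₂ v ∩ (connEvent ends a₂ z)ᶜ =
      clusterInEvent ends a₂ {L : Set V | z ∉ L} ∩ (connEvent ends a₁ v)ᶜ ∩
        avoidAll ends a₂ {a₁} := by
    rw [N_eq_inter]
    ext ω
    simp only [Set.mem_inter_iff, Set.mem_compl_iff, mem_connEvent, mem_clusterInEvent,
      Set.mem_setOf_eq, mem_cluster]
    tauto
  -- deletion stability
  have hBst : ∀ ω : Config E, ω ∈ avoidAll ends a₂ {a₁} →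
      (ω ∈ connEvent ends a₁ v ↔ delConfig ends (cluster ends ω a₂) ω ∈ connEvent ends a₁ v) :=
    fun ω hω => deletionStable_connEvent hω
  have hBcst : ∀ ω : Config E, ω ∈ avoidAll ends a₂ {a₁} →
      (ω ∈ (connEvent ends a₁ v)ᶜ ↔
        delConfig ends (cluster ends ω a₂) ω ∈ (connEvent ends a₁ v)ᶜ) :=
    fun ω hω => deletionStable_connEvent_compl hω
  have e1 := prob_clusterIn_inter_avoid_inter_eq_expect p ends a₂ (X := {a₁})
    {L : Set V | y ∉ L} (connEvent ends a₁ v) hBst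
  have e2 := prob_clusterIn_inter_avoid_inter_eq_expect p ends a₂ (X := {a₁})
    ({L : Set V | y ∉ L} ∩ {L : Set V | z ∉ L}) (connEvent ends a₁ v) hBst
  have e3 := prob_clusterIn_inter_avoid_inter_eq_expect p ends a₂ (X := {a₁})
    Set.univ (connEvent ends a₁ v)ᶜ hBcst
  have e4 := prob_clusterIn_inter_avoid_inter_eq_expect p ends a₂ (X := {a₁})
    {L : Set V | z ∉ L} (connEvent ends a₁ v)ᶜ hBcst
  rw [eUZ, eU, eNZ, eN, e1, e2, e3, e4]
  -- the functionals
  have hgBc_mono : Monotone (delProb p ends (connEvent ends a₁ v)ᶜ) :=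
    delProb_mono hp ((isUpperSet_connEvent ends a₁ v).compl)
  have hgB_eq : ∀ W, delProb p ends (connEvent ends a₁ v) W =
      1 - delProb p ends (connEvent ends a₁ v)ᶜ W := by
    intro W
    rw [delProb_compl]
    ring
  have hgB_anti : Antitone (delProb p ends (connEvent ends a₁ v)) := by
    intro W W' h
    rw [hgB_eq, hgB_eq]
    exact sub_le_sub_left (hgBc_mono h) 1
  have hgB0 : ∀ W, 0 ≤ delProb p ends (connEvent ends a₁ v) W := fun W => delProb_nonneg hp _ W
  have hgB1 : ∀ W, delProb p ends (connEvent ends a₁ v) W ≤ 1 := fun W => delProb_le_one' hp _ W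
  have hgBc0 : ∀ W, 0 ≤ delProb p ends (connEvent ends a₁ v)ᶜ W := fun W => delProb_nonneg hp _ W
  have hind_anti : ∀ (x : V),
      Antitone (({L : Set V | x ∉ L} : Set (Set V)).indicator (1 : Set V → R)) := by
    intro x W W' h
    by_cases hW' : x ∉ W'
    · have hW : x ∉ W := fun hx => hW' (h hx)
      simp [Set.indicator_of_mem, hW, hW']
    · rw [Set.indicator_of_notMem hW']
      exact Set.indicator_apply_nonneg fun _ => zero_le_one
  have hind01 : ∀ (𝓤 : Set (Set V)) (W : Set V), 0 ≤ 𝓤.indicator (1 : Set V → R) W ∧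
      𝓤.indicator (1 : Set V → R) W ≤ 1 := by
    intro 𝓤 W
    by_cases hW : W ∈ 𝓤
    · simp [Set.indicator_of_mem hW]
    · simp [Set.indicator_of_notMem hW]
  have hF_anti : Antitone (fun W : Set V => ({L : Set V | y ∉ L} : Set (Set V)).indicator
      (1 : Set V → R) W * delProb p ends (connEvent ends a₁ v) W) := by
    intro W W' h
    exact mul_le_mul (hind_anti y h) (hgB_anti h) (hgB0 W') (hind01 _ W).1
  have hF1 : ∀ W : Set V, ({L : Set V | y ∉ L} : Set (Set V)).indicator (1 : Set V → R) W *
      delProb p ends (connEvent ends a₁ v) W ≤ 1 := fun W => by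
    calc ({L : Set V | y ∉ L} : Set (Set V)).indicator (1 : Set V → R) W *
          delProb p ends (connEvent ends a₁ v) W ≤ 1 * 1 :=
          mul_le_mul (hind01 _ W).2 (hgB1 W) (hgB0 W) zero_le_one
      _ = 1 := one_mul 1
  have hG_anti : Antitone (fun W : Set V => ({L : Set V | z ∉ L} : Set (Set V)).indicator
      (1 : Set V → R) W) := hind_anti z
  have hG1 : ∀ W : Set V, ({L : Set V | z ∉ L} : Set (Set V)).indicator (1 : Set V → R) W ≤ 1 :=
    fun W => (hind01 _ W).2
  -- (i): both decreasing, positively correlated under the avoided-cluster law of `a₂`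
  have key1 := PSRecords.bhk_same_cluster_anti p hp ends a₂ a₁ hF_anti hG_anti hF1 hG1
  -- (ii): increasing against decreasing, negatively correlated
  have key2 := bhk_same_cluster p hp ends a₂ a₁
    (F₁ := delProb p ends (connEvent ends a₁ v)ᶜ)
    (F₂ := fun W => 1 - ({L : Set V | z ∉ L} : Set (Set V)).indicator (1 : Set V → R) W)
    hgBc_mono (fun _ _ h => sub_le_sub_left (hG_anti h) 1) hgBc0
    (fun W => sub_nonneg.2 (hG1 W))
  rw [← avoidAll_singleton_eq_compl a₂ a₁] at key1 key2
  -- align the functional forms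
  have hFG : (fun ω => ({L : Set V | y ∉ L} : Set (Set V)).indicator (1 : Set V → R)
      (cluster ends ω a₂) * delProb p ends (connEvent ends a₁ v) (cluster ends ω a₂) *
      ({L : Set V | z ∉ L} : Set (Set V)).indicator (1 : Set V → R) (cluster ends ω a₂) *
      (avoidAll ends a₂ {a₁}).indicator 1 ω) =
      fun ω => ({L : Set V | y ∉ L} ∩ {L : Set V | z ∉ L} : Set (Set V)).indicator (1 : Set V → R)
        (cluster ends ω a₂) * delProb p ends (connEvent ends a₁ v) (cluster ends ω a₂) *
        (avoidAll ends a₂ {a₁}).indicator 1 ω := by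
    funext ω
    by_cases h1 : cluster ends ω a₂ ∈ ({L : Set V | y ∉ L} : Set (Set V)) <;>
      by_cases h2 : cluster ends ω a₂ ∈ ({L : Set V | z ∉ L} : Set (Set V)) <;>
      simp [h1, h2]
  rw [hFG] at key1
  have hN_univ : (fun ω => Set.univ.indicator (1 : Set V → R) (cluster ends ω a₂) *
      delProb p ends (connEvent ends a₁ v)ᶜ (cluster ends ω a₂) *
      (avoidAll ends a₂ {a₁}).indicator 1 ω) =
      fun ω => delProb p ends (connEvent ends a₁ v)ᶜ (cluster ends ω a₂) *
        (avoidAll ends a₂ {a₁}).indicator 1 ω := by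
    funext ω; simp
  have hNZ_fun : (fun ω => ({L : Set V | z ∉ L} : Set (Set V)).indicator (1 : Set V → R)
      (cluster ends ω a₂) * delProb p ends (connEvent ends a₁ v)ᶜ (cluster ends ω a₂) *
      (avoidAll ends a₂ {a₁}).indicator 1 ω) =
      fun ω => delProb p ends (connEvent ends a₁ v)ᶜ (cluster ends ω a₂) *
        ({L : Set V | z ∉ L} : Set (Set V)).indicator (1 : Set V → R) (cluster ends ω a₂) *
        (avoidAll ends a₂ {a₁}).indicator 1 ω := by
    funext ω; ring
  rw [hN_univ, hNZ_fun]
  have hsub1 : (fun ω => (1 - ({L : Set V | z ∉ L} : Set (Set V)).indicator (1 : Set V → R)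
      (cluster ends ω a₂)) * (avoidAll ends a₂ {a₁}).indicator 1 ω) =
      (avoidAll ends a₂ {a₁}).indicator 1 - fun ω =>
        ({L : Set V | z ∉ L} : Set (Set V)).indicator (1 : Set V → R) (cluster ends ω a₂) *
          (avoidAll ends a₂ {a₁}).indicator 1 ω := by
    funext ω; simp only [Pi.sub_apply]; ring
  have hsub2 : (fun ω => delProb p ends (connEvent ends a₁ v)ᶜ (cluster ends ω a₂) *
      (1 - ({L : Set V | z ∉ L} : Set (Set V)).indicator (1 : Set V → R) (cluster ends ω a₂)) *
      (avoidAll ends a₂ {a₁}).indicator 1 ω) =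
      (fun ω => delProb p ends (connEvent ends a₁ v)ᶜ (cluster ends ω a₂) *
        (avoidAll ends a₂ {a₁}).indicator 1 ω) -
      fun ω => delProb p ends (connEvent ends a₁ v)ᶜ (cluster ends ω a₂) *
        ({L : Set V | z ∉ L} : Set (Set V)).indicator (1 : Set V → R) (cluster ends ω a₂) *
        (avoidAll ends a₂ {a₁}).indicator 1 ω := by
    funext ω; simp only [Pi.sub_apply]; ring
  rw [hsub1, hsub2, expect_sub, expect_sub, ← prob_eq_expect_indicator] at key2
  -- nonnegativity and the bound `a ≤ q`
  have hind0 : ∀ ω, 0 ≤ (avoidAll ends a₂ {a₁}).indicator (1 : Config E → R) ω :=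
    fun ω => Set.indicator_apply_nonneg fun _ => zero_le_one
  have ha0 : 0 ≤ expect p fun ω => ({L : Set V | y ∉ L} : Set (Set V)).indicator (1 : Set V → R)
      (cluster ends ω a₂) * delProb p ends (connEvent ends a₁ v) (cluster ends ω a₂) *
      (avoidAll ends a₂ {a₁}).indicator 1 ω :=
    expect_nonneg hp fun ω => mul_nonneg (mul_nonneg (hind01 _ _).1 (hgB0 _)) (hind0 ω)
  have hc0 : 0 ≤ expect p fun ω => ({L : Set V | y ∉ L} ∩ {L : Set V | z ∉ L} : Set (Set V)).indicator
      (1 : Set V → R) (cluster ends ω a₂) * delProb p ends (connEvent ends a₁ v) (cluster ends ω a₂) *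
      (avoidAll ends a₂ {a₁}).indicator 1 ω :=
    expect_nonneg hp fun ω => mul_nonneg (mul_nonneg (hind01 _ _).1 (hgB0 _)) (hind0 ω)
  have hd0 : 0 ≤ expect p fun ω => delProb p ends (connEvent ends a₁ v)ᶜ (cluster ends ω a₂) *
      (avoidAll ends a₂ {a₁}).indicator 1 ω :=
    expect_nonneg hp fun ω => mul_nonneg (hgBc0 _) (hind0 ω)
  have hq0 : 0 ≤ prob p (avoidAll ends a₂ {a₁}) := prob_nonneg hp _
  have haq : (expect p fun ω => ({L : Set V | y ∉ L} : Set (Set V)).indicator (1 : Set V → R)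
      (cluster ends ω a₂) * delProb p ends (connEvent ends a₁ v) (cluster ends ω a₂) *
      (avoidAll ends a₂ {a₁}).indicator 1 ω) ≤ prob p (avoidAll ends a₂ {a₁}) := by
    rw [prob_eq_expect_indicator]
    refine expect_mono hp fun ω => ?_
    by_cases hω : ω ∈ avoidAll ends a₂ {a₁}
    · simp only [Set.indicator_of_mem hω, Pi.one_apply, mul_one]
      exact hF1 _
    · simp [Set.indicator_of_notMem hω]
  have h2 : (expect p fun ω => delProb p ends (connEvent ends a₁ v)ᶜ (cluster ends ω a₂) *
      ({L : Set V | z ∉ L} : Set (Set V)).indicator (1 : Set V → R) (cluster ends ω a₂) *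
      (avoidAll ends a₂ {a₁}).indicator 1 ω) * prob p (avoidAll ends a₂ {a₁}) ≤
      (expect p fun ω => delProb p ends (connEvent ends a₁ v)ᶜ (cluster ends ω a₂) *
        (avoidAll ends a₂ {a₁}).indicator 1 ω) *
      expect p (fun ω => ({L : Set V | z ∉ L} : Set (Set V)).indicator (1 : Set V → R)
        (cluster ends ω a₂) * (avoidAll ends a₂ {a₁}).indicator 1 ω) := by
    nlinarith [key2]
  exact ratio_combine key1 h2 ha0 hc0 hd0 hq0 haq

end OneWorld

end KPrime

end Summit.Ventures.PercRepro2
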